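import Summits.QuantumFields.QCD.Theorems.GaussianLinkFramesFrameFMClosurePlacementSidesAux4

/-!
# Crux `GaussianLinkFrames.FrameFMClosure` (stmt-QuantumFields-17375), line `pad-the-fibre`, stub
`stub_placementSides` — helper 5: blocks for the BOX-COMPLEMENT side `A = (ebox S z r)ᶜ` (layered flip)

The complementary arc of the even box is ODD, so the box complement is not globally domino-paired in one
coordinate.  The pairing used is LAYERED: a site of `A` whose coordinate `λ` lies INSIDE the box is flipped in `λ`
along the box tiling (it stays in `A`, its outside coordinate being another one); a site whose coordinate `λ` lies
OUTSIDE the box is flipped in a second coordinate `ν` inside its own pad's `4`-range (it stays in `A` through `λ`).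
This file provides the one-dimensional data: in coordinate `λ` every residue — except the antipodal residue of the
thinnest complement `r = S - 1` — admits a pad position whose refitted block meets the box in dominoes of the
tiling (`boxc_coord_data`, extending helper 3 to residues outside the box); in coordinate `ν` the two pads' `4`-ranges
are ALIGNED (same parity or disjoint) so that one map `πν` restricts to the domino flip of each (`nu_align`); and
the resulting block of one point with its stability statements (`boxc_block`).

References: elementary [folklore]; the pad recipe is the line card of `pad-the-fibre`.
-/

noncomputable section

open scoped BigOperators
open Literature.MathematicalPhysics.QuantumFieldTheory Literature.MathematicalPhysics.QuantumLattice
  Literature.Probability.LatticeModels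
open Summit.QuantumFields.QCD.Theorems.VonMisesCircles Summit.QuantumFields.QCD.Theorems.PadTheFibre

namespace Summit.QuantumFields.QCD.Theorems.PadTheFibreTwoStar

/-! ## §1 Coordinate `λ`: aligned pads for residues inside or outside the box -/

/-- **Aligned pad data in the layer coordinate of the box complement.**  As `box_coord_data` (helper 3), for a residue
`c₀` that is either inside the box (box-offset `≤ 2r+1`) or anywhere when the complementary arc has `≥ 3` residues
(`2r + 5 ≤ N`): a pad base `B`, frozen data `(M, cf)` with `M ⊆ {lam}`, and a window `[k₁, k₂]` of box-offsets
(`k₁` even, `k₂` odd, `k₂ ≤ 2r+1`, possibly empty) such that `c₀` is in the core away from the frozen layer, a residue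
inside the box lies in the refitted block iff its box-offset is in the window, and the window lies in the block.
[folklore] -/
theorem boxc_coord_data {N : ℕ} [NeZero N] (lam : Fin 4) (r : ℕ) (hr : 1 ≤ r) (hN : 2 * r + 3 ≤ N) (L c₀ : ZMod N)
    (hc₀ : (c₀ - L).val ≤ 2 * r + 1 ∨ 2 * r + 5 ≤ N) :
    ∃ (B : ZMod N) (M : Finset (Fin 4)) (cf : Fin 4 → ℤ) (k₁ k₂ : ℕ), (∀ μ ∈ M, cf μ = -2 ∨ cf μ = 1) ∧
      (∀ μ ∈ M, μ = lam) ∧ ((c₀ - B).val = 1 ∨ (c₀ - B).val = 2) ∧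
      (∀ μ ∈ M, (cf μ = -2 → (c₀ - B).val = 2) ∧ (cf μ = 1 → (c₀ - B).val = 1)) ∧
      Even k₁ ∧ Odd k₂ ∧ k₂ ≤ 2 * r + 1 ∧
      ∀ u : ZMod N,
        (((u - B).val ≤ 3 ∧ ∀ μ ∈ M, ((u - B).val : ℤ) ≠ cf μ + 2) ∧ (u - L).val ≤ 2 * r + 1 →
            k₁ ≤ (u - L).val ∧ (u - L).val ≤ k₂) ∧
        (k₁ ≤ (u - L).val ∧ (u - L).val ≤ k₂ → (u - B).val ≤ 3 ∧ ∀ μ ∈ M, ((u - B).val : ℤ) ≠ cf μ + 2) := by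
  classical
  by_cases hin : (c₀ - L).val ≤ 2 * r + 1
  · -- inside the box: helper 3, with the frozen coordinate renamed `0 ↦ lam`
    obtain ⟨B, M₀, cf, k₁, k₂, hcf, hM0, hcore, hfar, hk₁, hk₂, hk₂r, hwin⟩ := box_coord_data r hr hN L c₀ hin
    refine ⟨B, if (0 : Fin 4) ∈ M₀ then {lam} else ∅, fun _ => cf 0, k₁, k₂, fun μ hμ => ?_, fun μ hμ => ?_, hcore,
      fun μ hμ => ?_, hk₁, hk₂, hk₂r, fun u => ⟨fun h => (hwin u).1 ⟨⟨h.1.1, fun μ' hμ' => ?_⟩, h.2⟩, fun h => ?_⟩⟩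
    · split_ifs at hμ with h0
      · exact hcf 0 h0
      · exact (Finset.notMem_empty μ hμ).elim
    · split_ifs at hμ with h0
      · exact Finset.mem_singleton.1 hμ
      · exact (Finset.notMem_empty μ hμ).elim
    · split_ifs at hμ with h0
      · exact hfar 0 h0
      · exact (Finset.notMem_empty μ hμ).elim
    · have e := hM0 μ' hμ'; subst e
      exact h.1.2 lam (by rw [if_pos hμ']; exact Finset.mem_singleton_self _)
    · refine ⟨((hwin u).2 h).1, fun μ hμ => ?_⟩
      split_ifs at hμ with h0
      · exact ((hwin u).2 h).2 0 h0
      · exact (Finset.notMem_empty μ hμ).elim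
  · -- outside the box, complementary arc of `≥ 3` residues
    have hN5 : 2 * r + 5 ≤ N := hc₀.resolve_left hin
    set d := (c₀ - L).val with hd
    have hdN : d < N := ZMod.val_lt _
    have hd2 : 2 * r + 2 ≤ d := by omega
    have hc2 : (c₀ - (c₀ - 2)).val = 2 := by
      rw [show c₀ - (c₀ - 2) = ((2 : ℕ) : ZMod N) by push_cast; ring, ZMod.val_cast_of_lt (by omega)]
    have hc1 : (c₀ - (c₀ - 1)).val = 1 := by
      rw [show c₀ - (c₀ - 1) = ((1 : ℕ) : ZMod N) by push_cast; ring, ZMod.val_cast_of_lt (by omega)]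
    have hB2 : ∀ u : ZMod N, (u - (c₀ - 2)).val =
        if d - 2 ≤ (u - L).val then (u - L).val - (d - 2) else (u - L).val + N - (d - 2) := by
      intro u
      refine val_sub_transfer L (c₀ - 2) (d - 2) ?_ u
      rw [show c₀ - 2 - L = (c₀ - L) - ((2 : ℕ) : ZMod N) by push_cast; ring]
      exact val_sub_natCast_of_le _ 2 (by omega)
    have hB1 : ∀ u : ZMod N, (u - (c₀ - 1)).val =
        if d - 1 ≤ (u - L).val then (u - L).val - (d - 1) else (u - L).val + N - (d - 1) := by
      intro u
      refine val_sub_transfer L (c₀ - 1) (d - 1) ?_ u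
      rw [show c₀ - 1 - L = (c₀ - L) - ((1 : ℕ) : ZMod N) by push_cast; ring]
      exact val_sub_natCast_of_le _ 1 (by omega)
    by_cases h1 : d = 2 * r + 2
    · -- just above the box: pad `[2r, 2r+3]`, window `{2r, 2r+1}`
      refine ⟨c₀ - 2, ∅, fun _ => 0, 2 * r, 2 * r + 1, by simp, by simp, Or.inr hc2, by simp, ⟨r, by ring⟩,
        ⟨r, by ring⟩, le_rfl, fun u => ?_⟩
      have hul : (u - L).val < N := ZMod.val_lt _
      have ht := hB2 u
      simp only [Finset.notMem_empty, false_implies, implies_true, and_true]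
      constructor
      · rintro ⟨hs, htl⟩; rw [ht] at hs; split_ifs at hs with h <;> omega
      · rintro ⟨h1, h3⟩; rw [ht, if_pos (by omega)]; omega
    by_cases h2 : d = N - 1
    · -- just below the box: pad `[N-2, N+1]`, window `{0, 1}`
      refine ⟨c₀ - 1, ∅, fun _ => 0, 0, 1, by simp, by simp, Or.inl hc1, by simp, ⟨0, rfl⟩, ⟨0, rfl⟩, by omega,
        fun u => ?_⟩
      have hul : (u - L).val < N := ZMod.val_lt _
      have ht := hB1 u
      simp only [Finset.notMem_empty, false_implies, implies_true, and_true]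
      constructor
      · rintro ⟨hs, htl⟩; rw [ht] at hs; split_ifs at hs with h <;> omega
      · rintro ⟨h1, h3⟩; rw [ht, if_neg (by omega)]; omega
    by_cases h3 : d = 2 * r + 3 ∧ N = 2 * r + 5
    · -- the middle of a three-residue arc: pad `[2r+1, 2r+4]` with the bottom layer (`= U`) frozen, empty window
      refine ⟨c₀ - 2, {lam}, fun _ => -2, 2, 1, by simp, by simp, Or.inr hc2, fun μ _ => ⟨fun _ => hc2, fun h => ?_⟩,
        ⟨1, rfl⟩, ⟨0, rfl⟩, by omega, fun u => ⟨?_, fun h => by omega⟩⟩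
      · norm_num at h
      · rintro ⟨⟨hs, hs0⟩, htl⟩
        have hs0' := hs0 lam (Finset.mem_singleton_self _)
        rw [hB2 u] at hs hs0'
        split_ifs at hs hs0' with h
        · have : (u - L).val - (d - 2) = 0 := by omega
          exact (hs0' (by rw [this]; norm_num)).elim
        · omega
    by_cases h4 : d = 2 * r + 3
    · -- second residue of a longer arc: pad `[2r+2, 2r+5]`, empty window
      have hN6 : 2 * r + 6 ≤ N := by omega
      refine ⟨c₀ - 1, ∅, fun _ => 0, 2, 1, by simp, by simp, Or.inl hc1, by simp, ⟨1, rfl⟩, ⟨0, rfl⟩, by omega,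
        fun u => ⟨?_, fun h => by omega⟩⟩
      rintro ⟨⟨hs, -⟩, htl⟩; rw [hB1 u] at hs; split_ifs at hs with h <;> omega
    · -- deep in the arc: pad `[d-2, d+1]`, empty window
      have hd4 : 2 * r + 4 ≤ d ∧ d ≤ N - 2 := by omega
      refine ⟨c₀ - 2, ∅, fun _ => 0, 2, 1, by simp, by simp, Or.inr hc2, by simp, ⟨1, rfl⟩, ⟨0, rfl⟩, by omega,
        fun u => ⟨?_, fun h => by omega⟩⟩
      rintro ⟨⟨hs, -⟩, htl⟩; rw [hB2 u] at hs; split_ifs at hs with h <;> omega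

/-! ## §2 Coordinate `ν`: aligning the two `4`-ranges -/

/-- **Alignment of the flip coordinate.**  For two residues `aν, bν` (`9 ≤ N`) there are pad bases `sa, sb` holding
them in the cores of the `4`-ranges `[sa, sa+3]`, `[sb, sb+3]`, chosen with equal parity when the ranges are close, so
that the single map `πν` — the domino flip from `sa` on the first range and from `sb` elsewhere — restricts to the
domino flip from `sa` on the first range and from `sb` on the second. [folklore] -/
theorem nu_align {N : ℕ} [NeZero N] (hN : 9 ≤ N) (aν bν : ZMod N) :
    ∃ sa sb : ZMod N, ((aν - sa).val = 1 ∨ (aν - sa).val = 2) ∧ ((bν - sb).val = 1 ∨ (bν - sb).val = 2) ∧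
      let fl : ZMod N → ZMod N → ZMod N := fun s u => if Even (u - s).val then u + 1 else u - 1
      let πν : ZMod N → ZMod N := fun u => if (u - sa).val ≤ 3 then fl sa u else fl sb u
      (∀ u, (u - sa).val ≤ 3 → πν u = fl sa u) ∧ (∀ u, (u - sb).val ≤ 3 → πν u = fl sb u) := by
  have hc2 : ∀ c : ZMod N, (c - (c - 2)).val = 2 := fun c => by
    rw [show c - (c - 2) = ((2 : ℕ) : ZMod N) by push_cast; ring, ZMod.val_cast_of_lt (by omega)]
  have hc1 : ∀ c : ZMod N, (c - (c - 1)).val = 1 := fun c => by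
    rw [show c - (c - 1) = ((1 : ℕ) : ZMod N) by push_cast; ring, ZMod.val_cast_of_lt (by omega)]
  -- the generic consistency statement: offsets of `sb` from `sa` even and small, or large
  have key : ∀ sa sb : ZMod N, ((sb - sa).val ≤ 4 ∧ Even (sb - sa).val) ∨ ((sa - sb).val ≤ 4 ∧ Even (sa - sb).val) ∨
      (5 ≤ (sb - sa).val ∧ (sb - sa).val + 5 ≤ N) →
      let fl : ZMod N → ZMod N → ZMod N := fun s u => if Even (u - s).val then u + 1 else u - 1
      let πν : ZMod N → ZMod N := fun u => if (u - sa).val ≤ 3 then fl sa u else fl sb u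
      (∀ u, (u - sa).val ≤ 3 → πν u = fl sa u) ∧ (∀ u, (u - sb).val ≤ 3 → πν u = fl sb u) := by
    intro sa sb h fl πν
    refine ⟨fun u hu => if_pos hu, fun u hu => ?_⟩
    show (if (u - sa).val ≤ 3 then fl sa u else fl sb u) = fl sb u
    split_ifs with hua
    · -- both flips read the same parity
      show (if Even (u - sa).val then u + 1 else u - 1) = (if Even (u - sb).val then u + 1 else u - 1)
      have hpar : Even (u - sa).val ↔ Even (u - sb).val := by
        rcases h with ⟨h1, m, hm⟩ | ⟨h1, m, hm⟩ | ⟨h1, h2⟩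
        · have := val_sub_rebase_of_lt u sa sb (by omega)
          rw [this]
          exact ⟨fun ⟨k, hk⟩ => ⟨k - m, by omega⟩, fun ⟨k, hk⟩ => ⟨k + m, by omega⟩⟩
        · rcases val_sub_add_val_sub sa sb with ⟨h0, -⟩ | hs
          · have : sa = sb := sub_eq_zero.1 ((ZMod.val_eq_zero _).1 h0)
            rw [this]
          · rcases lt_or_ge ((u - sb).val + (sb - sa).val) N with hlt | hge
            · have := val_sub_rebase_of_lt u sa sb hlt
              omega
            · have := val_sub_rebase_of_le u sa sb hge
              rw [this]
              exact ⟨fun ⟨k, hk⟩ => ⟨k + m, by omega⟩, fun ⟨k, hk⟩ => ⟨k - m, by omega⟩⟩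
        · exfalso
          rcases lt_or_ge ((u - sb).val + (sb - sa).val) N with hlt | hge
          · have := val_sub_rebase_of_lt u sa sb hlt; omega
          · have := val_sub_rebase_of_le u sa sb hge; omega
      by_cases he : Even (u - sa).val
      · rw [if_pos he, if_pos (hpar.1 he)]
      · rw [if_neg he, if_neg (fun h => he (hpar.2 h))]
    · rfl
  set k := (bν - aν).val with hk
  have hkN : k < N := ZMod.val_lt _
  by_cases h4 : k ≤ 4
  · rcases Nat.even_or_odd k with ⟨m, hm⟩ | ⟨m, hm⟩
    · refine ⟨aν - 2, bν - 2, Or.inr (hc2 aν), Or.inr (hc2 bν), key _ _ (Or.inl ⟨?_, ?_⟩)⟩ <;>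
        rw [show bν - 2 - (aν - 2) = bν - aν by ring]
      · omega
      · exact ⟨m, hm⟩
    · have e : (bν - 1 - (aν - 2)).val = k + 1 := by
        rw [show bν - 1 - (aν - 2) = (bν - aν) + 1 by ring, val_add_one_of_lt _ (by omega)]
      refine ⟨aν - 2, bν - 1, Or.inr (hc2 aν), Or.inl (hc1 bν), key _ _ (Or.inl ⟨?_, ?_⟩)⟩ <;> rw [e]
      · omega
      · exact ⟨m + 1, by omega⟩
  by_cases h4' : (aν - bν).val ≤ 4
  · set k' := (aν - bν).val with hk'
    rcases Nat.even_or_odd k' with ⟨m, hm⟩ | ⟨m, hm⟩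
    · refine ⟨aν - 2, bν - 2, Or.inr (hc2 aν), Or.inr (hc2 bν), key _ _ (Or.inr (Or.inl ⟨?_, ?_⟩))⟩ <;>
        rw [show aν - 2 - (bν - 2) = aν - bν by ring]
      · omega
      · exact ⟨m, hm⟩
    · have e : (aν - 1 - (bν - 2)).val = k' + 1 := by
        rw [show aν - 1 - (bν - 2) = (aν - bν) + 1 by ring, val_add_one_of_lt _ (by omega)]
      refine ⟨aν - 1, bν - 2, Or.inl (hc1 aν), Or.inr (hc2 bν), key _ _ (Or.inr (Or.inl ⟨?_, ?_⟩))⟩ <;> rw [e]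
      · omega
      · exact ⟨m + 1, by omega⟩
  · refine ⟨aν - 2, bν - 2, Or.inr (hc2 aν), Or.inr (hc2 bν), key _ _ (Or.inr (Or.inr ?_))⟩
    rw [show bν - 2 - (aν - 2) = bν - aν by ring]
    rcases val_sub_add_val_sub bν aν with ⟨h0, -⟩ | hs
    · omega
    · constructor <;> omega

/-! ## §3 The block of one point for the box complement -/

/-- **The block of a point for the box-complement side** (`2 ≤ S`, `1 ≤ r`, `r + 1 ≤ S`; layer coordinate `lam`,
flip coordinate `nu ≠ lam`, a `4`-range base `sν` holding `c nu` in its core, and `c lam` inside the box or the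
complementary arc of `≥ 3` residues).  There are a pad centre `x'` holding `c` in its core and frozen data `(M, cf)`
such that the star of `c` lies in the interior `P`, every interior site has its `nu`-coordinate in the `4`-range, and:
an interior site of `A = (ebox S z r)ᶜ` whose `lam`-coordinate is INSIDE the box stays in `P ∩ A` with inside
`lam`-coordinate under the box-tiling flip of coordinate `lam` (an involutive `±1` move), while one whose
`lam`-coordinate is OUTSIDE stays in `P ∩ A` when its `nu`-coordinate is replaced by any residue of the `4`-range.
[folklore] -/
theorem boxc_block {S : ℕ} (hS : 2 ≤ S) (z : TorusSite 4 (2 * S + 1)) (r : ℕ) (hr₁ : 1 ≤ r) (hr₂ : r + 1 ≤ S)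
    (lam nu : Fin 4) (hln : lam ≠ nu) (c : TorusSite 4 (2 * S + 1)) (sν : ZMod (2 * S + 1))
    (hsν : (c nu - sν).val = 1 ∨ (c nu - sν).val = 2)
    (hcl : (c lam - (z lam - ((r + 1 : ℕ) : ZMod (2 * S + 1)))).val ≤ 2 * r + 1 ∨ 2 * r + 5 ≤ 2 * S + 1) :
    ∃ (x' : TorusSite 4 (2 * S + 1)) (M : Finset (Fin 4)) (cf : Fin 4 → ℤ), (∀ μ ∈ M, cf μ = -2 ∨ cf μ = 1) ∧
      c ∈ ebox S x' 0 ∧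
      (c ∈ ebox S x' 1 \ padFrozen S x' M cf ∧ ∀ μ : Fin 4, c + Pi.single μ 1 ∈ ebox S x' 1 \ padFrozen S x' M cf ∧
        c - Pi.single μ 1 ∈ ebox S x' 1 \ padFrozen S x' M cf) ∧
      let L : ZMod (2 * S + 1) := z lam - ((r + 1 : ℕ) : ZMod (2 * S + 1))
      let πB : ZMod (2 * S + 1) → ZMod (2 * S + 1) := fun u => if Even (u - L).val then u + 1 else u - 1
      (∀ y ∈ ebox S x' 1 \ padFrozen S x' M cf, (y nu - sν).val ≤ 3) ∧
      (∀ y ∈ ebox S x' 1 \ padFrozen S x' M cf, y ∉ ebox S z r → (y lam - L).val ≤ 2 * r + 1 →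
        Function.update y lam (πB (y lam)) ∈ ebox S x' 1 \ padFrozen S x' M cf ∧
        Function.update y lam (πB (y lam)) ∉ ebox S z r ∧ (πB (y lam) - L).val ≤ 2 * r + 1 ∧
        πB (πB (y lam)) = y lam ∧ (πB (y lam) = y lam + 1 ∨ y lam = πB (y lam) + 1)) ∧
      (∀ y ∈ ebox S x' 1 \ padFrozen S x' M cf, y ∉ ebox S z r → ¬ (y lam - L).val ≤ 2 * r + 1 →
        ∀ v : ZMod (2 * S + 1), (v - sν).val ≤ 3 →
          Function.update y nu v ∈ ebox S x' 1 \ padFrozen S x' M cf ∧ Function.update y nu v ∉ ebox S z r) := by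
  haveI : NeZero (2 * S + 1) := ⟨by omega⟩
  set L0 : ZMod (2 * S + 1) := z lam - ((r + 1 : ℕ) : ZMod (2 * S + 1)) with hL0
  have hA : ∀ y : TorusSite 4 (2 * S + 1), y ∈ ebox S z r ↔
      ∀ i, (y i - (z i - ((r + 1 : ℕ) : ZMod (2 * S + 1)))).val ≤ 2 * r + 1 := by
    intro y
    rw [mem_ebox_iff_val z y r hr₂]
    have : ∀ i, y i - z i + ((r + 1 : ℕ) : ZMod (2 * S + 1)) = y i - (z i - ((r + 1 : ℕ) : ZMod (2 * S + 1))) :=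
      fun i => by ring
    simp only [this]
  obtain ⟨B, M, cf, k₁, k₂, hcfM, hMl, hcore, hfar, hk₁, hk₂, hk₂r, hwin⟩ :=
    boxc_coord_data lam r hr₁ (by omega) L0 (c lam) hcl
  set x' : TorusSite 4 (2 * S + 1) := fun j => if j = lam then B + 2 else if j = nu then sν + 2 else c j with hx'
  have hxl : x' lam = B + 2 := by simp [hx']
  have hxn : x' nu = sν + 2 := by simp [hx', hln.symm]
  have hxj : ∀ j, j ≠ lam → j ≠ nu → x' j = c j := fun j h1 h2 => by simp [hx', h1, h2]
  have hoffl : ∀ y : TorusSite 4 (2 * S + 1), y lam - x' lam + 2 = y lam - B := fun y => by rw [hxl]; ring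
  have hoffn : ∀ y : TorusSite 4 (2 * S + 1), y nu - x' nu + 2 = y nu - sν := fun y => by rw [hxn]; ring
  have hP : ∀ y : TorusSite 4 (2 * S + 1), y ∈ ebox S x' 1 \ padFrozen S x' M cf ↔
      (∀ j, j ≠ lam → j ≠ nu → (y j - c j + 2).val ≤ 3) ∧ (y nu - sν).val ≤ 3 ∧
        ((y lam - B).val ≤ 3 ∧ ∀ μ ∈ M, ((y lam - B).val : ℤ) ≠ cf μ + 2) := by
    intro y
    rw [mem_interior_iff_val hS x' y M cf]
    constructor
    · rintro ⟨h1, h2⟩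
      refine ⟨fun j hj1 hj2 => by rw [← hxj j hj1 hj2]; exact h1 j, by rw [← hoffn]; exact h1 nu,
        by rw [← hoffl]; exact h1 lam, fun μ hμ => ?_⟩
      have := h2 μ hμ
      have e := hMl μ hμ; subst e
      rwa [hoffl] at this
    · rintro ⟨h1, h2, h3, h4⟩
      refine ⟨fun j => ?_, fun μ hμ => ?_⟩
      · by_cases hj1 : j = lam
        · subst hj1; rw [hoffl]; exact h3
        by_cases hj2 : j = nu
        · subst hj2; rw [hoffn]; exact h2
        · rw [hxj j hj1 hj2]; exact h1 j hj1 hj2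
      · have e := hMl μ hμ; subst e
        rw [hoffl]; exact h4 μ hμ
  refine ⟨x', M, cf, hcfM, ?_, ?_, ?_⟩
  · rw [mem_core_iff_val (by omega) x' c]
    intro j
    by_cases hj1 : j = lam
    · subst hj1
      have h1 : 1 ≤ (c j - B).val := by rcases hcore with h | h <;> omega
      rw [show c j - x' j + 1 = (c j - B) - 1 by rw [hxl]; ring, val_sub_one_of_le _ h1]
      rcases hcore with h | h <;> omega
    by_cases hj2 : j = nu
    · subst hj2
      have h1 : 1 ≤ (c j - sν).val := by rcases hsν with h | h <;> omega
      rw [show c j - x' j + 1 = (c j - sν) - 1 by rw [hxn]; ring, val_sub_one_of_le _ h1]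
      rcases hsν with h | h <;> omega
    · rw [hxj j hj1 hj2, show c j - c j + 1 = ((1 : ℕ) : ZMod (2 * S + 1)) by push_cast; ring,
        ZMod.val_cast_of_lt (by omega)]
  · refine star_subset_interior hS x' c M cf hcfM (fun j => ?_) (fun μ hμ => ?_)
    · by_cases hj1 : j = lam
      · subst hj1; rw [hoffl]; exact hcore
      by_cases hj2 : j = nu
      · subst hj2; rw [hoffn]; exact hsν
      · rw [hxj j hj1 hj2, show c j - c j + 2 = ((2 : ℕ) : ZMod (2 * S + 1)) by push_cast; ring,
          ZMod.val_cast_of_lt (by omega)]; right; trivial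
    · have e := hMl μ hμ; subst e
      rw [hoffl]; exact hfar μ hμ
  · intro L πB
    refine ⟨fun y hy => ((hP y).1 hy).2.1, fun y hy hyA hin => ?_, fun y hy hyA hout v hv => ?_⟩
    · -- the layer coordinate inside the box: flip it along the tiling
      obtain ⟨hyo, hyn, hyl⟩ := (hP y).1 hy
      obtain ⟨hw1, hw2⟩ := (hwin (y lam)).1 ⟨hyl, hin⟩
      have F := flip_window L k₁ k₂ hk₁ hk₂ (by omega) (y lam) hw1 hw2
      obtain ⟨hF1, hF2, hFinv, hFnn, -⟩ := F
      refine ⟨?_, ?_, hF2.trans hk₂r, hFinv, hFnn⟩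
      · rw [hP]
        refine ⟨fun j hj1 hj2 => by rw [Function.update_of_ne hj1]; exact hyo j hj1 hj2,
          by rw [Function.update_of_ne hln.symm]; exact hyn, ?_⟩
        rw [Function.update_self]
        exact (hwin _).2 ⟨hF1, hF2⟩
      · rw [hA]
        intro h
        apply hyA
        rw [hA]
        intro i
        by_cases hi : i = lam
        · subst hi; exact hin
        · have := h i; rwa [Function.update_of_ne hi] at this
    · -- the layer coordinate outside the box: move the flip coordinate inside its range
      obtain ⟨hyo, hyn, hyl⟩ := (hP y).1 hy
      refine ⟨?_, ?_⟩
      · rw [hP]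
        refine ⟨fun j hj1 hj2 => by rw [Function.update_of_ne hj2]; exact hyo j hj1 hj2,
          by rw [Function.update_self]; exact hv, ?_⟩
        rw [Function.update_of_ne hln]
        exact hyl
      · rw [hA]
        intro h
        apply hout
        have := h lam
        rwa [Function.update_of_ne hln] at this

/-- **Registered helper `stub_placementSides_aux5` of crux stmt-QuantumFields-17375** (line `pad-the-fibre`, stub
`stub_placementSides`): aligned pad data in the layer coordinate of the box complement, for residues inside or outside the box. [folklore] -/
theorem stub_placementSides_aux5 : ∀ (N : ℕ) [NeZero N] (lam : Fin 4) (r : ℕ), 1 ≤ r → 2 * r + 3 ≤ N → ∀ (L c₀ : ZMod N), ((c₀ - L).val ≤ 2 * r + 1 ∨ 2 * r + 5 ≤ N) → ∃ (B : ZMod N) (M : Finset (Fin 4)) (cf : Fin 4 → ℤ) (k₁ k₂ : ℕ), (∀ μ ∈ M, cf μ = -2 ∨ cf μ = 1) ∧ (∀ μ ∈ M, μ = lam) ∧ ((c₀ - B).val = 1 ∨ (c₀ - B).val = 2) ∧ (∀ μ ∈ M, (cf μ = -2 → (c₀ - B).val = 2) ∧ (cf μ = 1 → (c₀ - B).val =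 1)) ∧ Even k₁ ∧ Odd k₂ ∧ k₂ ≤ 2 * r + 1 ∧ ∀ u : ZMod N, (((u - B).val ≤ 3 ∧ ∀ μ ∈ M, ((u - B).val : ℤ) ≠ cf μ + 2) ∧ (u - L).val ≤ 2 * r + 1 → k₁ ≤ (u - L).val ∧ (u - L).val ≤ k₂) ∧ (k₁ ≤ (u - L).val ∧ (u - L).val ≤ k₂ → (u - B).val ≤ 3 ∧ ∀ μ ∈ M, ((u - B).val : ℤ) ≠ cf μ + 2) :=
  fun _ _ lam r hr hN L c₀ hc₀ => boxc_coord_data lam r hr hN L c₀ hc₀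

end Summit.QuantumFields.QCD.Theorems.PadTheFibreTwoStar

end
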